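import Mathlib
import Summits.NavierStokesRegularity.NavierStokesRegularity.Theorems.TaoLadderRungTwoBreakOneShiftWindowTermFieldVarJets
import Summits.NavierStokesRegularity.NavierStokesRegularity.Theorems.TaoLadderRungTwoBreakOneShiftWindowSparseQuadD
import HarnessLib

/-!
# The one-shift window system, XXVII: HOMOGENISATION OF A TERM-LIST FIELD INTO A SPARSE QUADRATIC FIELD ON
# `Fin (n+1)` — the flow Taylor maps `tjet` and their derivatives `vjet` (parts XXIII/XXIV) ARE the Cauchy-product
# jets `taylorJet` / `varJet` of the homogenised field, so the interval machinery of part XXVI (`jetLevelsA`,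
# `varMatLevelsA` over `sqEvalA` / `sqJacA`) encloses them (cell harvest/h2-tao-ladder, seat p2;
# rung1/KERNEL-CHEAP-REPLAY-SPEC.md §2 (a)/(b)/(e), §7 «CHECKER» (a); support for K1(1) = `NoSurvivingDSSOne`,
# stmt-NavierStokesRegularity-20205)

MODEL lattice ODEs only (Tao 2016 §4 normal form on Tao's shift set `S`); nothing here is a statement about
the Navier–Stokes equations; no item is closed; nothing numerical is certified. Generic in `ι` (numbered by
`e : ι ≃ Fin n`) and `κ`.

A term-list field `termField T` (part XVIII) has products of state coordinates and EXTERNAL values (the frozen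
tails). Adjoining one coordinate `s` (index `Fin.last n`) with `s' = 0`, `s(0) = 1`, and reading an external factor
`r` as `r · s`, the field becomes the sparse homogeneous quadratic `homQ T e` on `Fin (n+1) → ℝ`
(`homQ u w c = Σ_t [out_t = c] coef_t · hval fa_t u · hval fb_t w`, last component `0`). By the uniqueness of the
truncated Cauchy-product recursions (`TaylorModelReadout.eq_taylorJet_of_rec` / `eq_varJet_of_rec`) and the real
recursions `tjet_succ` / `vjet_succ`:

* `taylorJet_homQ` — **`taylorJet (homQ T e) (hlift e x) k = hjet T e k x`**, the vector whose physical coordinates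
  are `tjet T k x` and whose last coordinate is `[k = 0]`;
* `varJet_homQ` — **`varJet (homQ T e) (hlift e x) (vlift e v) k = hvjet T e k x v`** (physical coordinates
  `vjet T k x v`, last coordinate `0`);
* read-outs for the checker: `mem_hjet_of_jetLevelsA` / `mem_tjet_of_jetLevelsA` (the materialised interval jets
  of ANY sparse interval presentation `SD` of `homQ T e` enclose the state jets over a box) and
  `mem_vjet_single_of_varMatLevelsA` (the all-directions variational table started from the identity `idBoxA`
  encloses the Jacobian entries `vjet T k x (e_l) i` — the `EV_j ∋ DΦ_j(W)` / `AK ∋ DΦ_K(S)` data of part XXV).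
-/

noncomputable section

-- the sub-problem namespace repeats the summit name by design (D-0017)
set_option linter.dupNamespace false

namespace Summit.NavierStokesRegularity.NavierStokesRegularity.Theorems

namespace DSSOneShift

open Set Finset
open Summit.NavierStokesRegularity.NavierStokesRegularity.Theorems.TaylorModelCert
open Summit.NavierStokesRegularity.NavierStokesRegularity.Theorems.TaylorModelReadout
open Summit.NavierStokesRegularity.NavierStokesRegularity.Theorems.CertificateGlueOn

variable {ι : Type*} [Fintype ι] [DecidableEq ι] {κ : Type*} [Fintype κ] {n : ℕ}

/-! ### The homogenised field -/

namespace Factor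

omit [Fintype ι] [DecidableEq ι] in
/-- The homogenised value of a factor on an extended vector: a coordinate reads its slot, an external value `r`
reads `r · u(last)`. [folklore] -/
def hval (e : ι ≃ Fin n) (u : Fin (n + 1) → ℝ) : Factor ι → ℝ
  | coord c => u (Fin.castSucc (e c))
  | ext r => r * u (Fin.last n)

end Factor

/-- **The homogenised sparse quadratic field** of a term list: physical component `c` is
`Σ_t [out_t = e⁻¹ c] coef_t · hval fa_t u · hval fb_t w`, the last component is `0`. [cite: Tao2016AveragedNS, §4 (4.8); cell vocabulary, harvest/h2-tao-ladder rung1/KERNEL-CHEAP-REPLAY-SPEC.md §1 (term list)] -/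
def homQ (T : κ → BTerm ι) (e : ι ≃ Fin n) (u w : Fin (n + 1) → ℝ) : Fin (n + 1) → ℝ :=
  Fin.snoc (fun c : Fin n => ∑ t, (T t).coefAt (e.symm c) * (T t).fa.hval e u * (T t).fb.hval e w) 0

omit [Fintype ι] in
/-- The homogenised state `(x, 1)`. [folklore] -/
def hlift (e : ι ≃ Fin n) (x : ι → ℝ) : Fin (n + 1) → ℝ := Fin.snoc (fun c => x (e.symm c)) 1

omit [Fintype ι] in
/-- The homogenised direction `(v, 0)`. [folklore] -/
def vlift (e : ι ≃ Fin n) (v : ι → ℝ) : Fin (n + 1) → ℝ := Fin.snoc (fun c => v (e.symm c)) 0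

/-- The homogenised state jet: physical coordinates `tjet T k x`, last coordinate `[k = 0]`. [folklore] -/
def hjet (T : κ → BTerm ι) (e : ι ≃ Fin n) (k : ℕ) (x : ι → ℝ) : Fin (n + 1) → ℝ :=
  Fin.snoc (fun c => tjet T k x (e.symm c)) (if k = 0 then 1 else 0)

/-- The homogenised variational jet: physical coordinates `vjet T k x v`, last coordinate `0`. [folklore] -/
def hvjet (T : κ → BTerm ι) (e : ι ≃ Fin n) (k : ℕ) (x v : ι → ℝ) : Fin (n + 1) → ℝ :=
  Fin.snoc (fun c => vjet T k x v (e.symm c)) 0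

omit [Fintype ι] in
/-- Physical components of `homQ`. [folklore] -/
theorem homQ_castSucc (T : κ → BTerm ι) (e : ι ≃ Fin n) (u w : Fin (n + 1) → ℝ) (c : Fin n) :
    homQ T e u w (Fin.castSucc c) = ∑ t, (T t).coefAt (e.symm c) * (T t).fa.hval e u * (T t).fb.hval e w := by
  simp only [homQ, Fin.snoc_castSucc]

omit [Fintype ι] in
/-- Last component of `homQ`. [folklore] -/
theorem homQ_last (T : κ → BTerm ι) (e : ι ≃ Fin n) (u w : Fin (n + 1) → ℝ) : homQ T e u w (Fin.last n) = 0 := by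
  simp only [homQ, Fin.snoc_last]

/-- Physical components of `hjet`. [folklore] -/
theorem hjet_castSucc (T : κ → BTerm ι) (e : ι ≃ Fin n) (k : ℕ) (x : ι → ℝ) (c : Fin n) :
    hjet T e k x (Fin.castSucc c) = tjet T k x (e.symm c) := by
  simp only [hjet, Fin.snoc_castSucc]

/-- Last component of `hjet`. [folklore] -/
theorem hjet_last (T : κ → BTerm ι) (e : ι ≃ Fin n) (k : ℕ) (x : ι → ℝ) :
    hjet T e k x (Fin.last n) = if k = 0 then 1 else 0 := by
  simp only [hjet, Fin.snoc_last]

/-- Physical components of `hvjet`. [folklore] -/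
theorem hvjet_castSucc (T : κ → BTerm ι) (e : ι ≃ Fin n) (k : ℕ) (x v : ι → ℝ) (c : Fin n) :
    hvjet T e k x v (Fin.castSucc c) = vjet T k x v (e.symm c) := by
  simp only [hvjet, Fin.snoc_castSucc]

/-- Last component of `hvjet`. [folklore] -/
theorem hvjet_last (T : κ → BTerm ι) (e : ι ≃ Fin n) (k : ℕ) (x v : ι → ℝ) : hvjet T e k x v (Fin.last n) = 0 := by
  simp only [hvjet, Fin.snoc_last]

/-- A factor's homogenised value on the state jet is its jet value. [folklore] -/
theorem hval_hjet (T : κ → BTerm ι) (e : ι ≃ Fin n) (φ : Factor ι) (k : ℕ) (x : ι → ℝ) :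
    φ.hval e (hjet T e k x) = φ.jetVal T k x := by
  cases φ with
  | coord c => simp [Factor.hval, hjet_castSucc, Factor.jetVal]
  | ext r =>
    simp only [Factor.hval, hjet_last, Factor.jetVal]
    split_ifs <;> simp

/-- A factor's homogenised value on the variational jet is its derivative jet value. [folklore] -/
theorem hval_hvjet (T : κ → BTerm ι) (e : ι ≃ Fin n) (φ : Factor ι) (k : ℕ) (x v : ι → ℝ) :
    φ.hval e (hvjet T e k x v) = φ.djetVal T k x v := by
  cases φ with
  | coord c => simp [Factor.hval, hvjet_castSucc, Factor.djetVal]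
  | ext r => simp [Factor.hval, hvjet_last, Factor.djetVal]

/-- `hjet 0 = hlift`. [folklore] -/
theorem hjet_zero (T : κ → BTerm ι) (e : ι ≃ Fin n) (x : ι → ℝ) : hjet T e 0 x = hlift e x := by
  simp only [hjet, hlift, tjet_zero, if_true]

/-- `hvjet 0 = vlift`. [folklore] -/
theorem hvjet_zero (T : κ → BTerm ι) (e : ι ≃ Fin n) (x v : ι → ℝ) : hvjet T e 0 x v = vlift e v := by
  simp only [hvjet, vlift, vjet_zero]

/-! ### The state jets of the homogenised field are `tjet` -/

/-- The homogenised state jets satisfy the Cauchy-product recursion of `homQ`. [cite: Moore1979, §3.4 eqs. (3.17)–(3.18)] -/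
theorem hjet_rec (T : κ → BTerm ι) (e : ι ≃ Fin n) (x : ι → ℝ) (m : ℕ) :
    ((m : ℝ) + 1) • hjet T e (m + 1) x =
      ∑ i ∈ range (m + 1), homQ T e (hjet T e i x) (hjet T e (m - i) x) := by
  funext c
  rw [Pi.smul_apply, smul_eq_mul, Finset.sum_apply]
  induction c using Fin.lastCases with
  | last => simp [hjet_last, homQ_last]
  | cast c =>
    simp only [hjet_castSucc, homQ_castSucc, hval_hjet]
    rw [tjet_succ T m x (e.symm c), Finset.sum_comm]
    refine Finset.sum_congr rfl fun t _ => ?_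
    rw [Finset.Nat.sum_antidiagonal_eq_sum_range_succ
      (fun p q => (T t).fa.jetVal T p x * (T t).fb.jetVal T q x) m, Finset.mul_sum]
    exact Finset.sum_congr rfl fun i _ => by ring

/-- **The Taylor jets of the homogenised field are the flow Taylor maps of the term-list field.** [cite: Moore1979, §3.4 eqs. (3.13)–(3.18); HairerWannerLubich2002, §III.5.1 eq. (5.8)] -/
theorem taylorJet_homQ (T : κ → BTerm ι) (e : ι ≃ Fin n) (x : ι → ℝ) (k : ℕ) :
    taylorJet (homQ T e) (hlift e x) k = hjet T e k x :=
  (eq_taylorJet_of_rec (homQ T e) (hlift e x) (p := k) (P := fun j => hjet T e j x) (hjet_zero T e x)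
    (fun m _ => hjet_rec T e x m) k le_rfl).symm

/-! ### The variational jets of the homogenised field are `vjet` -/

/-- The homogenised variational jets satisfy the variational recursion of `homQ` along `hjet`. [cite: WalawskaWilczak2016, §1.1; Moore1979, §3.4 eqs. (3.17)–(3.18)] -/
theorem hvjet_rec (T : κ → BTerm ι) (e : ι ≃ Fin n) (x v : ι → ℝ) (m : ℕ) :
    ((m : ℝ) + 1) • hvjet T e (m + 1) x v =
      ∑ i ∈ range (m + 1), (homQ T e (hjet T e i x) (hvjet T e (m - i) x v) +
        homQ T e (hvjet T e (m - i) x v) (hjet T e i x)) := by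
  funext c
  rw [Pi.smul_apply, smul_eq_mul, Finset.sum_apply]
  induction c using Fin.lastCases with
  | last => simp [hvjet_last, homQ_last]
  | cast c =>
    simp only [hvjet_castSucc, homQ_castSucc, hval_hjet, hval_hvjet, Pi.add_apply]
    rw [vjet_succ T m x v (e.symm c)]
    simp_rw [← Finset.sum_add_distrib]
    rw [Finset.sum_comm]
    refine Finset.sum_congr rfl fun t _ => ?_
    -- split the antidiagonal sum into its two halves and re-index the first by the swap
    have h1 : ∑ pq ∈ antidiagonal m, (T t).fa.djetVal T pq.1 x v * (T t).fb.jetVal T pq.2 x =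
        ∑ i ∈ range (m + 1), (T t).fa.djetVal T (m - i) x v * (T t).fb.jetVal T i x := by
      rw [← Finset.Nat.sum_antidiagonal_swap]
      simp only [Prod.fst_swap, Prod.snd_swap]
      exact Finset.Nat.sum_antidiagonal_eq_sum_range_succ
        (fun p q => (T t).fa.djetVal T q x v * (T t).fb.jetVal T p x) m
    have h2 : ∑ pq ∈ antidiagonal m, (T t).fa.jetVal T pq.1 x * (T t).fb.djetVal T pq.2 x v =
        ∑ i ∈ range (m + 1), (T t).fa.jetVal T i x * (T t).fb.djetVal T (m - i) x v :=
      Finset.Nat.sum_antidiagonal_eq_sum_range_succ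
        (fun p q => (T t).fa.jetVal T p x * (T t).fb.djetVal T q x v) m
    have hsplit : ∑ pq ∈ antidiagonal m, ((T t).fa.djetVal T pq.1 x v * (T t).fb.jetVal T pq.2 x +
        (T t).fa.jetVal T pq.1 x * (T t).fb.djetVal T pq.2 x v) =
        ∑ i ∈ range (m + 1), ((T t).fa.jetVal T i x * (T t).fb.djetVal T (m - i) x v +
          (T t).fa.djetVal T (m - i) x v * (T t).fb.jetVal T i x) := by
      rw [Finset.sum_add_distrib, h1, h2, ← Finset.sum_add_distrib]
      exact Finset.sum_congr rfl fun i _ => by ring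
    rw [hsplit, Finset.mul_sum]
    exact Finset.sum_congr rfl fun i _ => by ring

/-- **The variational jets of the homogenised field (directions `(v, 0)`) are the derivatives of the flow Taylor
maps of the term-list field.** [cite: WalawskaWilczak2016, §1.1 (ψ^[i]); Zgliczynski2002C1Lohner, §3] -/
theorem varJet_homQ (T : κ → BTerm ι) (e : ι ≃ Fin n) (x v : ι → ℝ) (k : ℕ) :
    varJet (homQ T e) (hlift e x) (vlift e v) k = hvjet T e k x v := by
  refine (eq_varJet_of_rec (homQ T e) (hlift e x) (vlift e v) (p := k) (W := fun j => hvjet T e j x v)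
    (hvjet_zero T e x v) (fun m _ => ?_) k le_rfl).symm
  simp only [taylorJet_homQ]
  exact hvjet_rec T e x v m

/-! ### Read-outs for the checker -/

omit [Fintype ι] [DecidableEq ι] in
/-- Physical coordinates of `hlift`. [folklore] -/
theorem rdN_hlift_of_lt (e : ι ≃ Fin n) (x : ι → ℝ) {c : ℕ} (hc : c < n) :
    rdN (hlift e x) c = x (e.symm ⟨c, hc⟩) := by
  rw [rdN_of_lt _ (Nat.lt_succ_of_lt hc)]
  have : (⟨c, Nat.lt_succ_of_lt hc⟩ : Fin (n + 1)) = Fin.castSucc ⟨c, hc⟩ := rfl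
  rw [this, hlift, Fin.snoc_castSucc]

omit [Fintype ι] [DecidableEq ι] in
/-- Last coordinate of `hlift`. [folklore] -/
theorem rdN_hlift_last (e : ι ≃ Fin n) (x : ι → ℝ) : rdN (hlift e x) n = 1 := by
  rw [rdN_of_lt _ (Nat.lt_succ_self n)]
  have : (⟨n, Nat.lt_succ_self n⟩ : Fin (n + 1)) = Fin.last n := rfl
  rw [this, hlift, Fin.snoc_last]

/-- Physical coordinates of `hjet`. [folklore] -/
theorem rdN_hjet_of_lt (T : κ → BTerm ι) (e : ι ≃ Fin n) (k : ℕ) (x : ι → ℝ) {c : ℕ} (hc : c < n) :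
    rdN (hjet T e k x) c = tjet T k x (e.symm ⟨c, hc⟩) := by
  rw [rdN_of_lt _ (Nat.lt_succ_of_lt hc)]
  have : (⟨c, Nat.lt_succ_of_lt hc⟩ : Fin (n + 1)) = Fin.castSucc ⟨c, hc⟩ := rfl
  rw [this, hjet_castSucc]

/-- Physical coordinates of `hvjet`. [folklore] -/
theorem rdN_hvjet_of_lt (T : κ → BTerm ι) (e : ι ≃ Fin n) (k : ℕ) (x v : ι → ℝ) {c : ℕ} (hc : c < n) :
    rdN (hvjet T e k x v) c = vjet T k x v (e.symm ⟨c, hc⟩) := by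
  rw [rdN_of_lt _ (Nat.lt_succ_of_lt hc)]
  have : (⟨c, Nat.lt_succ_of_lt hc⟩ : Fin (n + 1)) = Fin.castSucc ⟨c, hc⟩ := rfl
  rw [this, hvjet_castSucc]

omit [Fintype ι] [DecidableEq ι] in
/-- A box vector of size `n+1` CONTAINS the homogenised states over a box: physical slots contain the
coordinates, the last slot contains `1` (a bookkeeping predicate of the checker's data layout).
[cite: Moore1979, §2.1 (interval vectors); cell vocabulary, harvest/h2-tao-ladder rung1/KERNEL-CHEAP-REPLAY-SPEC.md §1] -/
def HBoxMem (e : ι ≃ Fin n) (Y : Array IntervalD) (x : ι → ℝ) : Prop :=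
  (∀ c (hc : c < n), IntervalD.mem (x (e.symm ⟨c, hc⟩)) (IntervalD.aget Y c)) ∧ IntervalD.mem 1 (IntervalD.aget Y n)

omit [Fintype ι] [DecidableEq ι] in
/-- `HBoxMem` gives the reader hypothesis of the array theorems. [folklore] -/
theorem HBoxMem.rdN {e : ι ≃ Fin n} {Y : Array IntervalD} {x : ι → ℝ} (h : HBoxMem e Y x) :
    ∀ c < n + 1, IntervalD.mem (rdN (hlift e x) c) (IntervalD.aget Y c) := by
  intro c hc
  rcases Nat.lt_succ_iff_lt_or_eq.1 hc with hc' | rfl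
  · rw [rdN_hlift_of_lt e x hc']; exact h.1 c hc'
  · rw [rdN_hlift_last]; exact h.2

/-- The materialised interval jets enclose the homogenised state jets `hjet` (all `n+1` coordinates) over a box —
the state-level hypothesis `hLs` of `mem_vjet_single_of_varMatLevelsA`. [cite: Moore1979, §3.4 and §8.1 eq. (8.9)] -/
theorem mem_hjet_of_jetLevelsA (T : κ → BTerm ι) (e : ι ≃ Fin n) {SD : SQRows}
    (hSD : IsSQEnclosure (homQ T e) SD) (prec K : ℕ) {Y : Array IntervalD} (hY : Y.size = n + 1)
    {x : ι → ℝ} (hx : HBoxMem e Y x) :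
    ∀ i ≤ K, ∀ c < n + 1, IntervalD.mem (rdN (hjet T e i x) c)
      (IntervalD.aget (IntervalD.lget (IntervalD.jetLevelsA (n + 1) (sqEvalA (n + 1) prec SD) prec Y K) i) c) := by
  intro i hi c hc
  have h := mem_taylorJet_of_jetLevelsA_sq hSD prec K hY hx.rdN i hi c hc
  rwa [taylorJet_homQ] at h

/-- **THE MATERIALISED INTERVAL JETS ENCLOSE `tjet` OVER A BOX**: for any sparse interval presentation `SD` of
`homQ T e` and any `x` whose homogenised state lies in the box vector `Y` (size `n+1`), `tjet T k x (e⁻¹ c) ∈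
(jetLevelsA (n+1) (sqEvalA (n+1) prec SD) prec Y K)[k][c]` for `k ≤ K`, `c < n` — the boxes `E_j ⊇ Φ_j(W)`,
`V ⊇ Φ_K(S)` of part XXV. [cite: Moore1979, §3.4 and §8.1 eq. (8.9); cell vocabulary, harvest/h2-tao-ladder rung1/KERNEL-CHEAP-REPLAY-SPEC.md §2 (a)/(b)] -/
theorem mem_tjet_of_jetLevelsA (T : κ → BTerm ι) (e : ι ≃ Fin n) {SD : SQRows}
    (hSD : IsSQEnclosure (homQ T e) SD) (prec K : ℕ) {Y : Array IntervalD} (hY : Y.size = n + 1)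
    {x : ι → ℝ} (hx : HBoxMem e Y x) {k : ℕ} (hk : k ≤ K) {c : ℕ} (hc : c < n) :
    IntervalD.mem (tjet T k x (e.symm ⟨c, hc⟩))
      (IntervalD.aget (IntervalD.lget (IntervalD.jetLevelsA (n + 1) (sqEvalA (n + 1) prec SD) prec Y K) k) c) := by
  have h := mem_hjet_of_jetLevelsA T e hSD prec K hY hx k hk c (Nat.lt_succ_of_lt hc)
  rwa [rdN_hjet_of_lt T e k x hc] at h

/-- The identity matrix as point boxes, flattened column-major (`(c, j) ↦ j·N + c`). [folklore] -/
def idBoxA (N : ℕ) : Array IntervalD :=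
  Array.ofFn fun t : Fin (N * N) => if t.val / N = t.val % N then IntervalD.ofInt 1 else IntervalD.ofInt 0

omit [Fintype ι] [DecidableEq ι] in
/-- The identity boxes enclose the basis vectors. [folklore] -/
theorem mem_idBoxA (N : ℕ) {j : ℕ} (hj : j < N) {c : ℕ} (hc : c < N) :
    IntervalD.mem (rdN (Pi.single (⟨j, hj⟩ : Fin N) (1 : ℝ)) c) (IntervalD.aget (idBoxA N) (j * N + c)) := by
  have hflat : j * N + c < N * N ∧ (j * N + c) / N = j ∧ (j * N + c) % N = c :=
    ⟨by nlinarith [Nat.mul_le_mul_right N (Nat.succ_le_of_lt hj)],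
      by rw [add_comm, Nat.add_mul_div_right _ _ (Nat.zero_lt_of_lt hc), Nat.div_eq_of_lt hc, zero_add],
      by rw [add_comm, Nat.add_mul_mod_self_right, Nat.mod_eq_of_lt hc]⟩
  obtain ⟨h1, h2, h3⟩ := hflat
  unfold idBoxA
  rw [IntervalD.aget_ofFn _ h1]
  dsimp only
  rw [h2, h3, rdN_of_lt _ hc]
  by_cases h : j = c
  · subst h
    rw [if_pos rfl, Pi.single_eq_same]
    exact_mod_cast IntervalD.mem_ofInt 1
  · rw [if_neg h, Pi.single_eq_of_ne (fun h' => h (Fin.mk.inj h').symm)]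
    exact_mod_cast IntervalD.mem_ofInt 0

omit [Fintype ι] in
/-- The lifted basis vector is the basis vector of the physical slot. [folklore] -/
theorem vlift_single (e : ι ≃ Fin n) (l : ι) :
    vlift e (Pi.single l (1 : ℝ)) = Pi.single (Fin.castSucc (e l)) (1 : ℝ) := by
  funext c
  induction c using Fin.lastCases with
  | last => rw [vlift, Fin.snoc_last, Pi.single_eq_of_ne (Fin.castSucc_lt_last (e l)).ne']
  | cast c =>
    rw [vlift, Fin.snoc_castSucc]
    by_cases h : c = e l
    · subst h
      rw [Equiv.symm_apply_apply, Pi.single_eq_same, Pi.single_eq_same]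
    · rw [Pi.single_eq_of_ne (fun h' => h (e.symm_apply_eq.1 h')),
        Pi.single_eq_of_ne (fun h' => h (Fin.castSucc_inj.1 h'))]

/-- **THE ALL-DIRECTIONS VARIATIONAL TABLE FROM THE IDENTITY ENCLOSES THE JACOBIANS OF THE FLOW TAYLOR MAPS**:
with state levels `Ls` enclosing `hjet T e i x` (`i ≤ K`, e.g. `jetLevelsA` as above), for `k ≤ K` and physical
indices `i, l`: `vjet T k x (e_l) i ∈ V_k[e i][e l]` (entry `(e i, e l)` at `e l · (n+1) + e i`) — the interval
matrices `EV_j ∋ DΦ_j` / `AK ∋ DΦ_K` of part XXV. [cite: WalawskaWilczak2016, §1.1 and §2.1; Zgliczynski2002C1Lohner, §3–4] -/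
theorem mem_vjet_single_of_varMatLevelsA (T : κ → BTerm ι) (e : ι ≃ Fin n) {SD : SQRows}
    (hSD : IsSQEnclosure (homQ T e) SD) (prec K : ℕ) {Ls : Array (Array IntervalD)} {x : ι → ℝ}
    (hLs : ∀ i ≤ K, ∀ c < n + 1, IntervalD.mem (rdN (hjet T e i x) c) (IntervalD.aget (IntervalD.lget Ls i) c))
    {k : ℕ} (hk : k ≤ K) (i l : ι) :
    IntervalD.mem (vjet T k x (Pi.single l 1) i)
      (IntervalD.aget (IntervalD.lget (varMatLevelsA (n + 1) prec (jacLevelsA (sqJacA (n + 1) prec SD) Ls K)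
        (idBoxA (n + 1)) K) k) ((e l : ℕ) * (n + 1) + (e i : ℕ))) := by
  have hT : ∀ i ≤ K, ∀ c < n + 1, IntervalD.mem (rdN (taylorJet (homQ T e) (hlift e x) i) c)
      (IntervalD.aget (IntervalD.lget Ls i) c) := fun i hi c hc => by rw [taylorJet_homQ]; exact hLs i hi c hc
  have h := mem_varJet_of_varMatLevelsA_sq hSD prec K hT (D := idBoxA (n + 1))
    (vs := fun j => if hj : j < n + 1 then Pi.single (⟨j, hj⟩ : Fin (n + 1)) (1 : ℝ) else 0)
    (fun j hj c hc => by simp only [dif_pos hj]; exact mem_idBoxA (n + 1) hj hc)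
    k hk (e l) (Nat.lt_succ_of_lt (e l).isLt) (e i) (Nat.lt_succ_of_lt (e i).isLt)
  simp only [dif_pos (Nat.lt_succ_of_lt (e l).isLt)] at h
  have hsingle : (Pi.single (⟨(e l : ℕ), Nat.lt_succ_of_lt (e l).isLt⟩ : Fin (n + 1)) (1 : ℝ)) =
      vlift e (Pi.single l 1) := by
    rw [vlift_single]; rfl
  rw [hsingle, varJet_homQ, rdN_hvjet_of_lt T e k x _ (e i).isLt] at h
  simpa using h

end DSSOneShift

end Summit.NavierStokesRegularity.NavierStokesRegularity.Theorems
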